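import Summits.RiemannHypothesis.RiemannHypothesis.Theses.SpectralTrace
import Summits.RiemannHypothesis.RiemannHypothesis.Theorems.WindowTraceArch.Negative.LocalWeyl
import Summits.RiemannHypothesis.RiemannHypothesis.Theorems.SpectralTraceSpectralThesisClosedLadderCells
import Literature.NumberTheory.LFunctions.WeilMellinBounds
import HarnessLib

/-!
# `WindowStep` — negative-lane toolkit: the defect of a rung family is defined on ALL tests

Refuter (crux disprover) record for the crux `stmt-RiemannHypothesis-14659`
(`Summit.RiemannHypothesis.RiemannHypothesis.Theses.SpectralTrace.WindowStep`). The crux text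
and the line's first lemma (`CollarDefect`) speak of "the seed's defect on the new window",
`g ↦ W(g) − Σ_i ĝ(1/2 + iγ_i)`, for tests `g` supported BEYOND the window on which the family
reproduces `W`. This file makes that object honest, unconditionally:

* `summable_norm_weilMellin_of_windowTrace`: for a real family `γ` reproducing `W` on the Weil
  tests supported in `[-A, A]` (`A > 0`) and ANY Weil test `g` (any support), the family
  `i ↦ ĝ(1/2 + iγ_i)` is absolutely summable. Proof: local Weyl bound
  `#{i : γ_i ∈ [n, n+1]} ≤ C (1 + log(1 + |n|))` (`card_near_le_log_of_windowTrace`, landed) and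
  the cell decay `‖ĝ(1/2 + iu)‖ ≤ 16 D_g / (1 + n²)²` on `[n, n+1]` (`norm_weilMellin_cell_le`),
  summed over the cells (`summable_cellBound`).
* `windowDefect_eq_zero`: the defect `W(g) − Σ'_i ĝ(1/2 + iγ_i)` vanishes on the tests supported
  in the window (bookkeeping).

So the defect is a well-defined linear functional on all Weil tests, supported (as a
distribution) off `(−A, A)`; the rigidity files (`Nested`, `FiniteMoves`, `BothWays`) describe
what cancelling it by moving unit atoms can NOT look like.
-/

set_option linter.dupNamespace false

noncomputable section

open Complex Set Filter MeasureTheory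
open scoped Real Topology

namespace Summit.RiemannHypothesis.RiemannHypothesis.Theorems.WindowStep.Negative

open Literature.NumberTheory.LFunctions
open Summit.RiemannHypothesis.RiemannHypothesis.Theses.SpectralTrace
open Summit.RiemannHypothesis.RiemannHypothesis.Theorems.WindowTraceArch.Negative
open Summit.RiemannHypothesis.RiemannHypothesis.Theorems.SpectralThesis.Sketch.ClosedLadder

/-- **Absolute summability on every test.** A real family reproducing `W` on the Weil tests
supported in `[-A, A]` (`A > 0`) has `Σ_i ‖ĝ(1/2 + iγ_i)‖ < ∞` for EVERY Weil test `g`,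
whatever its support. [folklore] -/
theorem summable_norm_weilMellin_of_windowTrace {A : ℝ} (hA : 0 < A) {ι : Type*} {γ : ι → ℝ}
    (h : ∀ g : ℝ → ℂ, IsWeilTest g → tsupport g ⊆ Icc (-A) A →
      HasSum (fun i => weilMellin g (1 / 2 + (γ i : ℂ) * I)) (weilFunctional g))
    {g : ℝ → ℂ} (hg : IsWeilTest g) :
    Summable fun i => ‖weilMellin g (1 / 2 + (γ i : ℂ) * I)‖ := by
  obtain ⟨C, hC, hcard⟩ := card_near_le_log_of_windowTrace hA h
  set D : ℝ := weilDecayConst g + weilDecayConst (deriv (deriv g)) with hD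
  have hD0 : 0 ≤ D := add_nonneg (weilDecayConst_nonneg _) (weilDecayConst_nonneg _)
  -- integer cells `⌊γ_i⌋ = n`: finite, with `≤ C (1 + log (1 + |n|))` elements
  set cls : ι → ℤ := fun i => ⌊γ i⌋ with hcls
  have hcell : ∀ n : ℤ, Finite {i // cls i = n} ∧
      (Nat.card {i // cls i = n} : ℝ) ≤ C * (1 + Real.log (1 + |(n : ℝ)|)) := by
    intro n
    refine finite_and_natCard_le fun s hs => hcard n s fun i hi => ?_
    have hfl : ⌊γ i⌋ = n := hs i hi
    have h1 : (n : ℝ) ≤ γ i := by rw [← hfl]; exact Int.floor_le _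
    have h2 : γ i < n + 1 := by rw [← hfl]; exact Int.lt_floor_add_one _
    rw [abs_le]
    constructor <;> linarith
  -- the norm on a cell
  have hterm : ∀ (n : ℤ) (i : {i // cls i = n}),
      ‖weilMellin g (1 / 2 + (γ i.1 : ℂ) * I)‖ ≤ 16 * D / (1 + (n : ℝ) ^ 2) ^ 2 := by
    intro n i
    have hfl : ⌊γ i.1⌋ = n := i.2
    have h1 : ((⌊γ i.1⌋ : ℤ) : ℝ) ≤ γ i.1 := Int.floor_le _
    have h2 : γ i.1 < ((⌊γ i.1⌋ : ℤ) : ℝ) + 1 := Int.lt_floor_add_one _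
    rw [hfl] at h1 h2
    exact norm_weilMellin_cell_le hg ⟨h1, h2.le⟩
  -- regroup along the cells
  set F : ι → ℝ := fun i => ‖weilMellin g (1 / 2 + (γ i : ℂ) * I)‖ with hF
  have hF0 : ∀ i, 0 ≤ F i := fun i => norm_nonneg _
  suffices hσ : Summable (F ∘ Equiv.sigmaFiberEquiv cls) from
    (Equiv.summable_iff _).1 hσ
  refine (summable_sigma_of_nonneg fun _ => hF0 _).2 ⟨fun n => ?_, ?_⟩
  · haveI := (hcell n).1
    exact Summable.of_finite
  · refine Summable.of_nonneg_of_le (fun n => tsum_nonneg fun _ => hF0 _) (fun n => ?_)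
      (summable_cellBound C D hD0)
    haveI := (hcell n).1
    haveI : Fintype {i // cls i = n} := Fintype.ofFinite _
    simp only [Equiv.sigmaFiberEquiv_apply]
    rw [tsum_fintype]
    have hsum : ∑ i : {i // cls i = n}, F i.1 ≤
        (Fintype.card {i // cls i = n} : ℝ) * (16 * D / (1 + (n : ℝ) ^ 2) ^ 2) := by
      have := Finset.sum_le_card_nsmul (Finset.univ : Finset {i // cls i = n})
        (fun i => F i.1) (16 * D / (1 + (n : ℝ) ^ 2) ^ 2) fun i _ => hterm n i
      rwa [nsmul_eq_mul, Finset.card_univ] at this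
    have hcardn : (Fintype.card {i // cls i = n} : ℝ) ≤ C * (1 + Real.log (1 + |(n : ℝ)|)) := by
      rw [← Nat.card_eq_fintype_card]
      exact (hcell n).2
    have hlog : 1 + Real.log (1 + |(n : ℝ)|) ≤ 2 + |(n : ℝ)| := by
      have := Real.log_le_sub_one_of_pos (by positivity : 0 < 1 + |(n : ℝ)|)
      linarith
    have hb0 : 0 ≤ 16 * D / (1 + (n : ℝ) ^ 2) ^ 2 := by positivity
    calc ∑ i : {i // cls i = n}, F i.1
        ≤ (Fintype.card {i // cls i = n} : ℝ) * (16 * D / (1 + (n : ℝ) ^ 2) ^ 2) := hsum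
      _ ≤ C * (1 + Real.log (1 + |(n : ℝ)|)) * (16 * D / (1 + (n : ℝ) ^ 2) ^ 2) :=
          mul_le_mul_of_nonneg_right hcardn hb0
      _ ≤ C * (2 + |(n : ℝ)|) * (16 * D / (1 + (n : ℝ) ^ 2) ^ 2) := by
          apply mul_le_mul_of_nonneg_right _ hb0
          exact mul_le_mul_of_nonneg_left hlog hC.le

/-- The sum itself converges (complete space). [folklore] -/
theorem summable_weilMellin_of_windowTrace {A : ℝ} (hA : 0 < A) {ι : Type*} {γ : ι → ℝ}
    (h : ∀ g : ℝ → ℂ, IsWeilTest g → tsupport g ⊆ Icc (-A) A →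
      HasSum (fun i => weilMellin g (1 / 2 + (γ i : ℂ) * I)) (weilFunctional g))
    {g : ℝ → ℂ} (hg : IsWeilTest g) :
    Summable fun i => weilMellin g (1 / 2 + (γ i : ℂ) * I) :=
  (summable_norm_weilMellin_of_windowTrace hA h hg).of_norm

/-- **The window defect.** For a rung-`A` family and any Weil test `g`, the defect
`W(g) − Σ'_i ĝ(1/2 + iγ_i)` is a well-defined number; it VANISHES when `g` is supported in the
window. [folklore] -/
theorem windowDefect_eq_zero {A : ℝ} {ι : Type*} {γ : ι → ℝ}
    (h : ∀ g : ℝ → ℂ, IsWeilTest g → tsupport g ⊆ Icc (-A) A →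
      HasSum (fun i => weilMellin g (1 / 2 + (γ i : ℂ) * I)) (weilFunctional g))
    {g : ℝ → ℂ} (hg : IsWeilTest g) (hgs : tsupport g ⊆ Icc (-A) A) :
    weilFunctional g - ∑' i, weilMellin g (1 / 2 + (γ i : ℂ) * I) = 0 := by
  rw [(h g hg hgs).tsum_eq, sub_self]

/-- The defect is additive-compatible bookkeeping: on any test it is the limit of `W(g)` minus
the finite partial sums (the `HasSum` of the family to its `tsum`). [folklore] -/
theorem hasSum_weilMellin_tsum_of_windowTrace {A : ℝ} (hA : 0 < A) {ι : Type*} {γ : ι → ℝ}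
    (h : ∀ g : ℝ → ℂ, IsWeilTest g → tsupport g ⊆ Icc (-A) A →
      HasSum (fun i => weilMellin g (1 / 2 + (γ i : ℂ) * I)) (weilFunctional g))
    {g : ℝ → ℂ} (hg : IsWeilTest g) :
    HasSum (fun i => weilMellin g (1 / 2 + (γ i : ℂ) * I))
      (∑' i, weilMellin g (1 / 2 + (γ i : ℂ) * I)) :=
  (summable_weilMellin_of_windowTrace hA h hg).hasSum

end Summit.RiemannHypothesis.RiemannHypothesis.Theorems.WindowStep.Negative

end
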